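import Literature.ComputerArithmetic.Shewchuk1997.ExpansionArithmetic
import Literature.ComputerArithmetic.RumpOgitaOishi2008.ExtractVector
import Mathlib.Algebra.Order.Floor.Ring
import Mathlib.Tactic.Linarith
import Mathlib.Tactic.LinearCombination
import Mathlib.Tactic.Positivity
import Mathlib.Tactic.Ring
import Mathlib.Tactic.NormNum
import Mathlib.Tactic.GCongr

/-!
# Shewchuk (1997), §2.4: strongly nonoverlapping expansions and FAST-EXPANSION-SUM (Theorem 13, Lemmas 14–16)

J. R. Shewchuk, *Adaptive precision floating-point arithmetic and fast robust geometric
predicates*, Discrete Comput. Geom. 18 (1997) 305–363 [Shewchuk1997], §2.4 "Expansion addition",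
pp. 318–323: the STRONGLY NONOVERLAPPING property, the algorithm FAST-EXPANSION-SUM and its
analysis (Theorem 13 with Lemmas 14, 15, 16).  Sequel of `ExpansionArithmetic.lean` (§2.1–2.4 up to
Theorem 12: `Nonoverlapping`, `Nonadjacent`, `OnGrid`, `Below`, `IsExpansion`, FAST-TWO-SUM, TWO-SUM,
Corollary 8, GROW-EXPANSION), whose model, dictionary and grid-invariant proof style are kept.  As
printed (pp. 318–321):

> An expansion is *strongly nonoverlapping* if no two of its components are overlapping, no
> component is adjacent to two other components, and any pair of adjacent components have the
> property that both components can be expressed with a one-bit significand (that is, both are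
> powers of two). For instance, 11000 + 11 and 10000 + 1000 + 10 + 1 are both strongly
> nonoverlapping, but 11100 + 11 is not, nor is 100 + 10 + 1. [...] Any nonadjacent expansion is
> strongly nonoverlapping, and any strongly nonoverlapping expansion is nonoverlapping, but the
> converse implications do not apply.
> **Theorem 13.** Let `e = Σᵢ₌₁^m eᵢ` and `f = Σᵢ₌₁ⁿ fᵢ` be strongly nonoverlapping expansions of `m`
> and `n` `p`-bit components, respectively, where `p ≥ 4`. Suppose that the components of both `e`
> and `f` are sorted in order of increasing magnitude, except that any of the `eᵢ` or `fᵢ` may be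
> zero. On a machine whose arithmetic uses the round-to-even rule, the following algorithm will
> produce a strongly nonoverlapping expansion `h` such that `h = Σᵢ₌₁^{m+n} hᵢ = e + f`, where the
> components of `h` are also in order of increasing magnitude, except that any of the `hᵢ` may be
> zero.  FAST-EXPANSION-SUM(e, f): 1 Merge `e` and `f` into a single sequence `g`, in order of
> nondecreasing magnitude (possibly with interspersed zeros); 2 `(Q₂, h₁) ⇐ FAST-TWO-SUM(g₂, g₁)`;
> 3 for `i ⇐ 3` to `m + n`; 4 `(Qᵢ, hᵢ₋₁) ⇐ TWO-SUM(Qᵢ₋₁, gᵢ)`; 5 `h_{m+n} ⇐ Q_{m+n}`; 6 return `h`.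
> **Lemma 14 (Q Invariant).** At the end of each iteration of the for loop, the invariant
> `Qᵢ + Σⱼ₌₁^{i−1} hⱼ = Σⱼ₌₁^{i} gⱼ` holds. This assures us that after Line 5 is executed,
> `Σⱼ₌₁^{m+n} hⱼ = Σⱼ₌₁^{m+n} gⱼ`, so the algorithm produces a correct sum.
> **Lemma 15.** Let `ĝ = Σⱼ₌₁^k ĝⱼ` be a series formed by merging two strongly nonoverlapping
> expansions, or a subseries thereof. Suppose that `ĝ_k` is the largest component and has a nonzero
> bit of magnitude `2^i` or smaller for some integer `i`. Then `|Σⱼ₌₁^k ĝⱼ| < 2^i(2^{p+1} − 1)`, and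
> `|Σⱼ₌₁^{k−1} ĝⱼ| < 2^i(2^p)`.
> **Lemma 16.** The expansion `h` produced by FAST-EXPANSION-SUM is a nonoverlapping expansion whose
> components are in order of increasing magnitude (excepting zeros).

MODEL / DICTIONARY (as in `ExpansionArithmetic.lean`).
* Floats are `JeannerodRump2018.IsFloat p emin` over `ℚ` (precision `p`, gradual underflow, no
  overflow); `fl` is ANY round-to-nearest map `IsRoundNearest p emin fl`; "round-to-even" is
  `roundTiesEven p emin`.  Expansions are `List ℚ` from the smallest component.  The oriented gap
  conditions of §2.1 are `Below 1 x y` ("`y ∈ 2^s·ℤ` and `|x| < 2^s`": `x` lies nonoverlapping below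
  `y`) and `Below 2 x y` (nonadjacent below); "nonoverlapping [nonadjacent] and increasing except
  zeros" is `IsExpansion 1` [`IsExpansion 2`] = pairwise `Below 1` [`Below 2`]
  (`isExpansion_one_iff` / `_two_iff` relate them to the paper's pairwise `Nonoverlapping` /
  `Nonadjacent` for float components).
* STRONGLY NONOVERLAPPING is typed the same way, ORIENTED and PAIRWISE: `StrongBelow x y :=
  Below 2 x y ∨ (|x| = 2^a ∧ |y| = 2^(a+1))` — an earlier component `x` either lies nonadjacent below
  the later `y`, or the two form an adjacent pair of one-bit numbers ("adjacent only if both can be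
  expressed with a one-bit significand") — and `IsStrongExpansion l := l.Pairwise StrongBelow ∧` no
  nonzero component `y` has both magnitudes `|y|/2` and `2|y|` among the components ("no component
  is adjacent to two other components": in a list that is pairwise `StrongBelow`, a component
  adjacent to `y ≠ 0` has magnitude `|y|/2` (before `y`) or `2|y|` (after `y`), and two distinct
  components of magnitude `|y|/2` would overlap each other).  The paper's four examples are checked
  (`isStrongExpansion_example₁₋₄`), and "nonadjacent ⇒ strongly nonoverlapping ⇒ nonoverlapping"
  is `IsExpansion.isStrongExpansion_of_two`, `IsStrongExpansion.isExpansion`; "or a subseries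
  thereof" (Lemma 15) is `IsStrongExpansion.sublist`.
* Line 1 is the stable merge by magnitude `mergeExpansions` (core `List.merge`; on equal magnitudes
  the component of `e` goes first — any order of equal magnitudes is covered by the analysis);
  FAST-EXPANSION-SUM is `fastExpansionSum fl e f`, Lines 3–5 being GROW-EXPANSION (`growExpansion`)
  of `⟨g₃, …, g_{m+n}⟩` by `Q₂`; for `m + n ≤ 1` there is no Line 2 and `h = g`.
* "`ĝ_k` has a nonzero bit of magnitude `2^i` or smaller" is `¬ OnGrid (i + 1) ĝ_k` (`ĝ_k ∉ 2^(i+1)·ℤ`).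

ON THE PROOFS (recorded, not results).  Lemma 14 is Theorems 6–7 summed along the loop
(`sum_growExpansion`); Line 2's FAST-TWO-SUM(g₂, g₁) is legitimate because `|g₁| ≤ |g₂|` unless
`g₂ = 0`, when both error-free additions return `(g₁, 0)` (`fastTwoSum_eq_twoSum_of_abs_le`), so that
`h = GROW-EXPANSION(⟨g₂, …, g_{m+n}⟩, g₁)` (`fastExpansionSum_eq_growExpansion`).  Lemma 15: the
remark "because `ê` is strongly nonoverlapping, `|ê|` is less than `2^i(2^p − ½)`" is proved in the
invariant form `abs_sum_lt_of_isStrongExpansion` — a strongly nonoverlapping expansion of `p`-bit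
floats (`p ≥ 2`) all below `2^t` in magnitude sums to less than `2^t − 2^(t−p−1)` — by induction
from the top component `x = M·2^v` (`M` odd): the components nonadjacent below `x` are `< 2^(v−1)`;
a one-bit `x = ±2^v` has at most one adjacent partner `±2^(v−1)`, under which (the partner being
adjacent to nothing else) everything is `< 2^(v−2)`; the two printed bounds follow (`lemma15`, the
printed cases "`ĝ_k = 2^i`" / "`ĝ_k ≠ 2^i`" becoming "`|M| = 1`" / "`|M| ≠ 1`").  Lemma 16 — and
with it everything in Theorem 13 except the word "strongly" — is proved by running the loop forward
under the invariant `FesInv` ("`Q ∈ 2^g·ℤ`, every unprocessed `gⱼ ∈ 2^g·ℤ`, every output so far is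
`< 2^g` in magnitude", with Lemma 14 and "processed components ≤ unprocessed nonzero ones") instead of
the printed contradiction from a "first offending pair", whose footnote 5 ("It is implicitly assumed
here that the first offending pair is not separated by intervening zeros. [...] Trust me.") leaves a
case unwritten.  `FesInv.step`: after `(Q', h) ⇐ TWO-SUM(Q, gᵢ)` with `h ≠ 0`, `2^T ≤ |h| < 2^(T+1)`,
the rounded sum `Q'` is a multiple of `2^(T+1)` (Theorem 7: `|h| ≤ ½ulp(Q')`, `below_one_sub_fl`),
and so is every unprocessed `gⱼ` — otherwise `gⱼ` "has a nonzero bit of magnitude `2^T` or smaller",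
Lemma 15 gives `|Σ processed| < 2^T·2^p`, the outputs so far give `|Σ hs| < 2^g ≤ 2^T`
(`abs_sum_lt_two_zpow_of_isExpansion`, the printed "`|Σⱼ₌₁^{i−2} hⱼ| < 1`"), whence
`|Q + gᵢ| < 2^T(2^p + 1)` by Lemma 14, contradicting Corollary 8(a) (`|h| ≥ 2^T`).  This is the
printed argument "(1) versus (2)" with the normalisation "the exponent of `hᵢ₋₁` is zero" undone and
intervening zeros harmless; it uses neither `p ≥ 4` nor the tie rule, so Lemma 16 and `h = e + f`
hold for EVERY round-to-nearest and every `p ≥ 2` (`fastExpansionSum_nonoverlapping`; the paper's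
setting is `fastExpansionSum_nonoverlapping_roundTiesEven`).

ERRATUM (Theorem 13 as printed is false; the witnesses are NEW WORK and are proved in
`Summits/Ventures/CertifiedArithmetic/Expansions/FastExpansionSumCounterexample.lean`, not here).  The
conclusion "`h` is STRONGLY nonoverlapping" fails under round-to-even for every `p ≥ 4`: the strongly
nonoverlapping (indeed nonadjacent) inputs `e = ⟨2^p + 2⟩`, `f = ⟨−(2^(p−1) − 1), −2^p⟩` give
`g = ⟨−(2^(p−1) − 1), −2^p, 2^p + 2⟩`, `Q₂ = RNₑ(−(3·2^(p−1) − 1)) = −3·2^(p−1)` (a tie, broken to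
even), `h₁ = 1`, then `Q₃ = −(2^(p−1) − 2)` exactly, `h₂ = 0`, so `h = ⟨1, 0, −(2^(p−1) − 2)⟩`: the
nonzero components `1` and `−(2^(p−1) − 2)` are adjacent and the latter is not a power of two (for
`p = 4`: `e = ⟨18⟩`, `f = ⟨−7, −16⟩`, `h = ⟨1, 0, −6⟩`).  The printed proof (p. 322) breaks at
footnote 5: the adjacent pair is separated by the zero `h₂`, and its upper member `h₃ = Q₃` is
written by Line 5, not "computed by Line 4 from `Qᵢ` and `gᵢ₊₁`", so Corollary 8(b) does not bound
it.  (Adjacent pairs separated by a zero also occur inside `h`: for `p = 4` the nonadjacent inputs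
`e = ⟨−22, −64, 768⟩`, `f = ⟨2, 120, 768⟩` yield `h = ⟨0, −4, 0, −24, 64, 1536⟩` — exhaustive search,
not formalised.)  What holds is typed above: `h` is nonoverlapping, increasing except for zeros, and
sums to `e + f` (Lemmas 14 and 16).  Whether a property strictly between nonoverlapping and strongly
nonoverlapping is preserved by FAST-EXPANSION-SUM is not settled here.

PROVED HERE (0 named facts, 0 sorry): the definitions `StrongBelow`, `IsStrongExpansion`,
`mergeExpansions`, `fastExpansionSum`; the remarks of p. 319 (`IsExpansion.isStrongExpansion_of_two`,
`IsStrongExpansion.isExpansion`, `isStrongExpansion_example₁₋₄`); **Lemma 14**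
(`sum_fastExpansionSum`); **Lemma 15** (`lemma15`, `abs_sum_lt_of_isStrongExpansion`); **Lemma 16 /
Theorem 13 without "strongly"** (`FesInv.step`, `FesInv.isExpansion_growExpansion`,
`fastExpansionSum_nonoverlapping`, `fastExpansionSum_nonoverlapping_roundTiesEven`,
`fastExpansionSum_pairwise_nonoverlapping`).

NOT TYPED: the (false) strongly-nonoverlapping conclusion of Theorem 13 and pp. 322–323 of its
proof; the round-toward-zero variant (pp. 319, 323); Priest's renormalising variant [23]; the
zero-elimination and linear-time-merge implementation remarks; Corollary 22, §2.7–2.8.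
-/

namespace Literature.ComputerArithmetic.Shewchuk1997

open Literature.ComputerArithmetic.JeannerodRump2018
open Literature.ComputerArithmetic.BoldoJeannerodMelquiondMuller2023 hiding twoSum

variable {p : ℕ} {emin : ℤ} {fl : ℚ → ℚ}

/-! ### §2.4 Strongly nonoverlapping expansions -/

/-- STRONGLY NONOVERLAPPING, the pair condition (oriented, `x` the less significant component):
`x` lies 2-below `y` (nonadjacent), OR the two are the adjacent pair of one-bit numbers
`|x| = 2^a`, `|y| = 2^(a+1)` — "x_i and x_{i+1} are adjacent only if both can be expressed with a
one-bit significand (that is, both are powers of two)". [cite: Shewchuk1997, §2.4 p. 318] -/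
def StrongBelow (x y : ℚ) : Prop :=
  Below 2 x y ∨ ∃ a : ℤ, |x| = (2 : ℚ) ^ a ∧ |y| = (2 : ℚ) ^ (a + 1)

/-- **STRONGLY NONOVERLAPPING EXPANSION** (components smallest first, any of them may be zero):
every earlier component lies strongly below every later one, and "no component is adjacent to
two other components" — for a sorted nonoverlapping list this says that no nonzero component `y`
sees both magnitudes `|y|/2` and `2|y|` among the components. [cite: Shewchuk1997, §2.4 p. 318] -/
def IsStrongExpansion (l : List ℚ) : Prop :=
  l.Pairwise StrongBelow ∧ ∀ y ∈ l, y ≠ 0 → |y| / 2 ∈ l.map abs → 2 * |y| ∈ l.map abs → False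

/-- An adjacent pair of one-bit numbers is in particular nonoverlapping and ordered: the strong
pair condition implies the nonoverlapping one ("any strongly nonoverlapping expansion is
nonoverlapping"). [cite: Shewchuk1997, §2.4 p. 319] -/
theorem StrongBelow.below_one {x y : ℚ} (h : StrongBelow x y) : Below 1 x y := by
  rcases h with h | ⟨a, hx, hy⟩
  · exact h.anti (by norm_num)
  · refine ⟨a + 1, ?_, ?_⟩
    · rcases (abs_eq (zpow_nonneg (by norm_num : (0:ℚ) ≤ 2) (a + 1))).mp hy with h | h
      · exact ⟨1, by rw [h]; simp⟩
      · exact ⟨-1, by rw [h]; simp⟩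
    · rw [one_mul, hx]; exact zpow_lt_zpow_right₀ (by norm_num) (by omega)

/-- "Any strongly nonoverlapping expansion is nonoverlapping" (and sorted, except zeros).
[cite: Shewchuk1997, §2.4 p. 319] -/
theorem IsStrongExpansion.isExpansion {l : List ℚ} (h : IsStrongExpansion l) : IsExpansion 1 l :=
  h.1.imp fun hab => hab.below_one

/-- A strongly-below pair is ordered by magnitude when the upper number is nonzero.
[cite: Shewchuk1997, §2.4 p. 318; Thm 13 p. 319] -/
theorem StrongBelow.abs_lt {x y : ℚ} (h : StrongBelow x y) (hy : y ≠ 0) : |x| < |y| := by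
  rcases h with h | ⟨a, hx, hy'⟩
  · exact h.abs_lt (by norm_num) hy
  · rw [hx, hy']; exact zpow_lt_zpow_right₀ (by norm_num) (by omega)

/-- "a series formed by merging two strongly nonoverlapping expansions, or a subseries thereof":
the property passes to sublists. [cite: Shewchuk1997, Lemma 15 p. 320] -/
theorem IsStrongExpansion.sublist {l l' : List ℚ} (h : IsStrongExpansion l) (hl : l'.Sublist l) :
    IsStrongExpansion l' :=
  ⟨h.1.sublist hl, fun y hy hy0 h1 h2 =>
    h.2 y (hl.subset hy) hy0 ((hl.map abs).subset h1) ((hl.map abs).subset h2)⟩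

/-- In a list whose components pairwise lie 2-below each other, two members `x`, `y ≠ 0` never
have `2|x| = |y|`. [cite: Shewchuk1997, §2.4 p. 319] -/
theorem ne_half_of_isExpansion_two {l : List ℚ} (h : IsExpansion 2 l) {x y : ℚ} (hx : x ∈ l)
    (hy : y ∈ l) (hy0 : y ≠ 0) (hxy : 2 * |x| = |y|) : False := by
  have hx0 : x ≠ 0 := by
    intro h0; rw [h0, abs_zero, mul_zero] at hxy; exact hy0 (abs_eq_zero.mp hxy.symm)
  obtain ⟨i, hi, rfl⟩ := List.mem_iff_getElem.mp hx
  obtain ⟨j, hj, rfl⟩ := List.mem_iff_getElem.mp hy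
  have hne : i ≠ j := by
    rintro rfl
    have : |l[i]| = 0 := by linarith [abs_nonneg l[i]]
    exact hx0 (abs_eq_zero.mp this)
  rw [IsExpansion, List.pairwise_iff_getElem] at h
  rcases Nat.lt_or_gt_of_ne hne with hij | hji
  · obtain ⟨s, hs, hlt⟩ := h i j hi hj hij
    have := hs.two_zpow_le_abs hy0
    linarith
  · obtain ⟨s, hs, hlt⟩ := h j i hj hi hji
    have := hs.two_zpow_le_abs hx0
    linarith [abs_nonneg l[j]]

/-- "Any nonadjacent expansion is strongly nonoverlapping." [cite: Shewchuk1997, §2.4 p. 319] -/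
theorem IsExpansion.isStrongExpansion_of_two {l : List ℚ} (h : IsExpansion 2 l) :
    IsStrongExpansion l := by
  refine ⟨h.imp fun hab => Or.inl hab, fun y hy hy0 h1 _ => ?_⟩
  obtain ⟨x, hx, hxy⟩ := List.mem_map.mp h1
  exact ne_half_of_isExpansion_two h hx hy hy0 (by rw [hxy]; ring)

/-! #### Grid and magnitude bookkeeping for the sum bounds -/

/-- A grid contains the absolute values of its members. [cite: Shewchuk1997, §2.1 footnote 2] -/
theorem OnGrid.abs {s : ℤ} {a : ℚ} (h : OnGrid s a) : OnGrid s |a| := by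
  rcases le_or_gt 0 a with ha | ha
  · rwa [abs_of_nonneg ha]
  · rw [abs_of_neg ha]; exact h.neg

/-- `2^s` lies on every grid `2^g` with `g ≤ s`. [cite: Shewchuk1997, §2.1 footnote 2] -/
theorem OnGrid.two_zpow {g s : ℤ} (h : g ≤ s) : OnGrid g ((2 : ℚ) ^ s) :=
  (show OnGrid s ((2 : ℚ) ^ s) from ⟨1, by simp⟩).mono h

/-- Grids are closed under list sums. [cite: Shewchuk1997, §2.1 footnote 2] -/
theorem OnGrid.listSum {s : ℤ} {l : List ℚ} (h : ∀ x ∈ l, OnGrid s x) : OnGrid s l.sum := by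
  induction l with
  | nil => simpa using OnGrid.zero s
  | cons x xs ih =>
    rw [List.sum_cons]
    exact (h x (by simp)).add (ih fun y hy => h y (List.mem_cons_of_mem _ hy))

/-- Two grid points `a < b` of `2^g·ℤ` differ by at least the quantum: `a + 2^g ≤ b`.
[cite: Shewchuk1997, Lemma 15 p. 320 (proof)] -/
theorem OnGrid.add_two_zpow_le {g : ℤ} {a b : ℚ} (ha : OnGrid g a) (hb : OnGrid g b)
    (hab : a < b) : a + (2 : ℚ) ^ g ≤ b := by
  obtain ⟨m, rfl⟩ := ha
  obtain ⟨n, rfl⟩ := hb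
  have h2 : (0 : ℚ) < (2 : ℚ) ^ g := zpow_pos (by norm_num) _
  have hmn : (m : ℚ) < n := lt_of_mul_lt_mul_right hab h2.le
  have hmn' : m + 1 ≤ n := by exact_mod_cast hmn
  have : ((m : ℚ) + 1) * (2 : ℚ) ^ g ≤ (n : ℚ) * (2 : ℚ) ^ g :=
    mul_le_mul_of_nonneg_right (by exact_mod_cast hmn') h2.le
  linarith

/-- Every nonzero float has an ODD-SIGNIFICAND representation `x = M·2^v`, `M` odd, `|M| < 2^p`,
`v ≥ emin` (shift the trailing zero bits of the significand into the exponent).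
[cite: Shewchuk1997, §2.1 p. 308 (model)] -/
theorem exists_odd_mul_two_zpow {x : ℚ} (hx : IsFloat p emin x) (h0 : x ≠ 0) :
    ∃ M v : ℤ, Odd M ∧ |M| < 2 ^ p ∧ emin ≤ v ∧ x = (M : ℚ) * (2 : ℚ) ^ v := by
  obtain ⟨M, e, hM, he, rfl⟩ := hx
  have hM0 : M ≠ 0 := by rintro rfl; simp at h0
  -- strip factors of two from `M`
  suffices H : ∀ (n : ℕ) (M : ℤ), M.natAbs ≤ n → M ≠ 0 → |M| < 2 ^ p → ∀ e : ℤ, emin ≤ e →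
      ∃ M' v : ℤ, Odd M' ∧ |M'| < 2 ^ p ∧ emin ≤ v ∧
        (M : ℚ) * (2 : ℚ) ^ e = (M' : ℚ) * (2 : ℚ) ^ v from H M.natAbs M le_rfl hM0 hM e he
  intro n
  induction n with
  | zero =>
    intro M hn hM0
    exact absurd (Int.natAbs_eq_zero.mp (Nat.le_zero.mp hn)) hM0
  | succ n ih =>
    intro M hn hM0 hMp e he
    rcases Int.even_or_odd M with ⟨k, hk⟩ | hodd
    · have hk0 : k ≠ 0 := by rintro rfl; simp at hk; exact hM0 hk
      have hk2 : M = 2 * k := by rw [hk]; ring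
      have hkn : k.natAbs ≤ n := by
        have : M.natAbs = 2 * k.natAbs := by rw [hk2, Int.natAbs_mul]; rfl
        omega
      have hkp : |k| < 2 ^ p := by
        have : |M| = 2 * |k| := by rw [hk2, abs_mul]; rfl
        linarith [abs_nonneg k]
      obtain ⟨M', v, hM', hM'p, hv, hEq⟩ := ih k hkn hk0 hkp (e + 1) (by omega)
      refine ⟨M', v, hM', hM'p, hv, ?_⟩
      rw [← hEq, hk2, zpow_add_one₀ (by norm_num : (2:ℚ) ≠ 0)]
      push_cast; ring
    · exact ⟨M, e, hodd, hMp, he, rfl⟩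

/-- An odd multiple `M·2^v` of `2^v` lies on the grid `2^s` only for `s ≤ v` ("the least significant
nonzero bit" of `x` has magnitude `2^v`). [cite: Shewchuk1997, §2.1 p. 309 and footnote 2] -/
theorem OnGrid.le_of_odd {M v s : ℤ} (hM : Odd M) (h : OnGrid s ((M : ℚ) * (2 : ℚ) ^ v)) :
    s ≤ v := by
  by_contra hlt
  rw [not_le] at hlt
  obtain ⟨r, hr⟩ := h
  obtain ⟨d, hd⟩ := Int.eq_ofNat_of_zero_le (show 0 ≤ s - v - 1 by omega)
  have h2v : (0 : ℚ) < (2 : ℚ) ^ v := zpow_pos (by norm_num) _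
  have hs : s = v + ((d : ℤ) + 1) := by omega
  have hM' : (M : ℚ) = (r : ℚ) * 2 ^ (d + 1) := by
    have h1 : (M : ℚ) * (2 : ℚ) ^ v = ((r : ℚ) * (2 : ℚ) ^ (d + 1)) * (2 : ℚ) ^ v := by
      rw [hr, hs, zpow_add₀ (by norm_num : (2:ℚ) ≠ 0), ← zpow_natCast]; push_cast; ring
    exact mul_right_cancel₀ h2v.ne' h1
  have hM'' : M = r * 2 ^ (d + 1) := by exact_mod_cast hM'
  have : Even M := ⟨r * 2 ^ d, by rw [hM'', pow_succ]; ring⟩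
  exact (Int.not_even_iff_odd.mpr hM) this

/-- An odd multiple `M·2^v` is (up to sign) a power of two only if `|M| = 1` (and then the power is
`2^v`). [cite: Shewchuk1997, §2.4 p. 318 ("one-bit significand")] -/
theorem abs_eq_one_of_odd_of_abs_eq_two_zpow {M v b : ℤ} (hM : Odd M)
    (h : |(M : ℚ) * (2 : ℚ) ^ v| = (2 : ℚ) ^ b) : |M| = 1 ∧ b = v := by
  have h2v : (0 : ℚ) < (2 : ℚ) ^ v := zpow_pos (by norm_num) _
  have h2b : (0 : ℚ) < (2 : ℚ) ^ b := zpow_pos (by norm_num) _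
  have hM0 : M ≠ 0 := by rintro rfl; simp at h; exact h2b.ne' h.symm
  have habs : ((|M| : ℤ) : ℚ) * (2 : ℚ) ^ v = (2 : ℚ) ^ b := by
    rw [← h, abs_mul, abs_of_pos h2v, Int.cast_abs]
  have hMabs : Odd |M| := by
    rcases abs_choice M with hh | hh <;> rw [hh]
    · exact hM
    · exact hM.neg
  have hbv : b ≤ v := OnGrid.le_of_odd hMabs ⟨1, by rw [habs]; simp⟩
  have hle : (2 : ℚ) ^ b ≤ (2 : ℚ) ^ v := zpow_le_zpow_right₀ (by norm_num) hbv
  have h1 : ((|M| : ℤ) : ℚ) ≤ 1 := by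
    by_contra hlt; rw [not_le] at hlt
    have : (2 : ℚ) ^ v < ((|M| : ℤ) : ℚ) * (2 : ℚ) ^ v := lt_mul_of_one_lt_left h2v hlt
    linarith
  have h1' : |M| ≤ 1 := by exact_mod_cast h1
  have hone : |M| = 1 := le_antisymm h1' (Int.one_le_abs hM0)
  refine ⟨hone, le_antisymm hbv ?_⟩
  have : (2 : ℚ) ^ v = (2 : ℚ) ^ b := by rw [← habs, hone]; simp
  exact (zpow_right_injective₀ (by norm_num) (by norm_num) this).le

/-- Monotonicity of the slack bound `2^a − 2^(a−p−1) = 2^(a−p−1)(2^(p+1) − 1)` in `a`.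
[cite: Shewchuk1997, Lemma 15 p. 320–321 (proof)] -/
theorem two_zpow_sub_mono (p : ℕ) {a b : ℤ} (hab : a ≤ b) :
    (2 : ℚ) ^ a - (2 : ℚ) ^ (a - p - 1) ≤ (2 : ℚ) ^ b - (2 : ℚ) ^ (b - p - 1) := by
  have ha : (2 : ℚ) ^ a = (2 : ℚ) ^ (a - p - 1) * 2 ^ (p + 1) := by
    rw [← zpow_natCast, ← zpow_add₀ (by norm_num : (2:ℚ) ≠ 0)]; congr 1; push_cast; ring
  have hb : (2 : ℚ) ^ b = (2 : ℚ) ^ (b - p - 1) * 2 ^ (p + 1) := by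
    rw [← zpow_natCast, ← zpow_add₀ (by norm_num : (2:ℚ) ≠ 0)]; congr 1; push_cast; ring
  have hle : (2 : ℚ) ^ (a - p - 1) ≤ (2 : ℚ) ^ (b - p - 1) :=
    zpow_le_zpow_right₀ (by norm_num) (by omega)
  have hp1 : (1 : ℚ) ≤ 2 ^ (p + 1) := one_le_pow₀ (by norm_num)
  rw [ha, hb]
  nlinarith

/-- Binade step `2^a = 2·2^b` for `b + 1 = a`. [cite: Shewchuk1997, §2.1 p. 308 (model)] -/
theorem two_zpow_eq_two_mul {a b : ℤ} (h : b + 1 = a) : (2 : ℚ) ^ a = 2 * (2 : ℚ) ^ b := by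
  subst h; rw [zpow_add_one₀ (by norm_num : (2:ℚ) ≠ 0)]; ring

/-! #### The four examples of p. 319 -/

/-- "For instance, 11000 + 11 [is] strongly nonoverlapping" (`⟨3, 24⟩`, smallest first).
[cite: Shewchuk1997, §2.4 p. 319 (examples)] -/
theorem isStrongExpansion_example₁ : IsStrongExpansion [3, 24] := by
  refine ⟨List.Pairwise.cons ?_ (List.pairwise_singleton _ _), ?_⟩
  · intro y hy
    rw [List.mem_singleton.mp hy]
    exact Or.inl ⟨3, ⟨3, by norm_num⟩, by norm_num⟩
  · intro y hy hy0 h1 h2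
    simp only [List.map_cons, List.map_nil, List.mem_cons, List.not_mem_nil, or_false] at hy h1
    revert h1
    rcases hy with rfl | rfl <;> norm_num

/-- "10000 + 1000 + 10 + 1 [is] strongly nonoverlapping" (`⟨1, 2, 8, 16⟩`: two adjacent pairs of
one-bit components, no component adjacent to two others). [cite: Shewchuk1997, §2.4 p. 319 (examples)] -/
theorem isStrongExpansion_example₂ : IsStrongExpansion [1, 2, 8, 16] := by
  refine ⟨List.Pairwise.cons ?_ (List.Pairwise.cons ?_
    (List.Pairwise.cons ?_ (List.pairwise_singleton _ _))), ?_⟩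
  · intro y hy
    simp only [List.mem_cons, List.not_mem_nil, or_false] at hy
    rcases hy with rfl | rfl | rfl
    · exact Or.inr ⟨0, by norm_num, by norm_num⟩
    · exact Or.inl ⟨3, ⟨1, by norm_num⟩, by norm_num⟩
    · exact Or.inl ⟨4, ⟨1, by norm_num⟩, by norm_num⟩
  · intro y hy
    simp only [List.mem_cons, List.not_mem_nil, or_false] at hy
    rcases hy with rfl | rfl
    · exact Or.inl ⟨3, ⟨1, by norm_num⟩, by norm_num⟩
    · exact Or.inl ⟨4, ⟨1, by norm_num⟩, by norm_num⟩
  · intro y hy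
    rw [List.mem_singleton.mp hy]
    exact Or.inr ⟨3, by norm_num, by norm_num⟩
  · intro y hy hy0 h1 h2
    simp only [List.map_cons, List.map_nil, List.mem_cons, List.not_mem_nil, or_false] at hy h1 h2
    revert h1 h2
    rcases hy with rfl | rfl | rfl | rfl <;> norm_num

/-- "but 11100 + 11 is not" (`⟨3, 28⟩`: nonoverlapping, but adjacent and not both one-bit numbers).
[cite: Shewchuk1997, §2.4 p. 319 (examples)] -/
theorem isStrongExpansion_example₃ : ¬ IsStrongExpansion [3, 28] := by
  intro h
  have h' : StrongBelow 3 28 := (List.pairwise_cons.mp h.1).1 28 (by simp)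
  rcases h' with ⟨s, hs, hlt⟩ | ⟨a, ha, -⟩
  · have h28 : (28 : ℚ) = ((7 : ℤ) : ℚ) * (2 : ℚ) ^ (2 : ℤ) := by norm_num
    rw [h28] at hs
    have hs2 : s ≤ 2 := OnGrid.le_of_odd (by decide) hs
    have : (2 : ℚ) ^ s ≤ (2 : ℚ) ^ (2 : ℤ) := zpow_le_zpow_right₀ (by norm_num) hs2
    norm_num at hlt this
    linarith
  · have h3 : |((3 : ℤ) : ℚ) * (2 : ℚ) ^ (0 : ℤ)| = (2 : ℚ) ^ a := by
      rw [← ha]; norm_num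
    have := (abs_eq_one_of_odd_of_abs_eq_two_zpow (by decide) h3).1
    norm_num at this

/-- "nor is 100 + 10 + 1" (`⟨1, 2, 4⟩`: the middle component is adjacent to two others).
[cite: Shewchuk1997, §2.4 p. 319 (examples)] -/
theorem isStrongExpansion_example₄ : ¬ IsStrongExpansion [1, 2, 4] := fun h =>
  h.2 2 (by simp) (by norm_num) (by norm_num) (by norm_num)

/-! #### Sum bounds for nonoverlapping and strongly nonoverlapping expansions -/

/-- A nonoverlapping increasing expansion of floats whose components are all smaller than `2^s`
in magnitude sums to less than `2^s` in magnitude ("recalling that `hᵢ₋₁` is of the form `±1.∗`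
and `h₁, …, hᵢ₋₁` are nonoverlapping and increasing. Hence `|Σⱼ₌₁^{i−2} hⱼ| < 1`").
[cite: Shewchuk1997, Lemma 16 p. 321 (proof)] -/
theorem abs_sum_lt_two_zpow_of_isExpansion {l : List ℚ} (hl : ∀ x ∈ l, IsFloat p emin x)
    (hexp : IsExpansion 1 l) {s : ℤ} (hs : ∀ x ∈ l, |x| < (2 : ℚ) ^ s) :
    |l.sum| < (2 : ℚ) ^ s := by
  have h2s : (0 : ℚ) < (2 : ℚ) ^ s := zpow_pos (by norm_num) _
  induction l with
  | nil => simpa using h2s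
  | cons x xs ih =>
    obtain ⟨hxF, hxsF⟩ := List.forall_mem_cons.mp hl
    obtain ⟨hx1, hxs1⟩ := isExpansion_cons.mp hexp
    obtain ⟨hxs, hxss⟩ := List.forall_mem_cons.mp hs
    have ih' := ih hxsF hxs1 hxss
    rcases lt_or_ge s emin with hse | hse
    · -- everything is below `2^emin`, hence zero
      have hlt : (2 : ℚ) ^ s < (2 : ℚ) ^ emin := zpow_lt_zpow_right₀ (by norm_num) hse
      have hx0 : x = 0 := RumpOgitaOishi2008.eq_zero_of_isFloat_of_abs_lt hxF (lt_trans hxs hlt)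
      have hsum0 : xs.sum = 0 := List.sum_eq_zero fun y hy =>
        RumpOgitaOishi2008.eq_zero_of_isFloat_of_abs_lt (hxsF y hy) (lt_trans (hxss y hy) hlt)
      rw [List.sum_cons, hx0, hsum0]; simpa using h2s
    · obtain ⟨g, -, hgs, hxg, hG⟩ := exists_common_grid (c := 1) hxsF hx1 hse (by rwa [one_mul])
      rw [one_mul] at hxg
      have hsumG : OnGrid g xs.sum := OnGrid.listSum hG
      have hup : xs.sum + (2 : ℚ) ^ g ≤ (2 : ℚ) ^ s :=
        hsumG.add_two_zpow_le (OnGrid.two_zpow hgs) (lt_of_abs_lt ih')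
      have hlo : -(2 : ℚ) ^ s + (2 : ℚ) ^ g ≤ xs.sum :=
        (OnGrid.two_zpow hgs).neg.add_two_zpow_le hsumG (neg_lt_of_abs_lt ih')
      rw [List.sum_cons, abs_lt]
      obtain ⟨h1, h2⟩ := abs_lt.mp hxg
      constructor <;> linarith

/-- **The strongly-nonoverlapping sum bound** behind Lemma 15: a strongly nonoverlapping expansion
of `p`-bit floats (`p ≥ 2`) all of whose components are smaller than `2^t` in magnitude has
`|Σ| < 2^t − 2^(t−p−1)` — "because `ê` is strongly nonoverlapping, `|ê|` is less than
`2^i(2^p − ½)`. (For instance, if `p = 4` and `i = 0`, then `|ê| ≤ 1111.0111101111…`)".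
[cite: Shewchuk1997, Lemma 15 p. 320–321 (proof)] -/
theorem abs_sum_lt_of_isStrongExpansion (hp : 2 ≤ p) :
    ∀ (n : ℕ) (l : List ℚ), l.length ≤ n → (∀ x ∈ l, IsFloat p emin x) → IsStrongExpansion l →
      ∀ t : ℤ, (∀ x ∈ l, |x| < (2 : ℚ) ^ t) → |l.sum| < (2 : ℚ) ^ t - (2 : ℚ) ^ (t - p - 1) := by
  have h2 : (0 : ℚ) < 2 := by norm_num
  have slack_pos : ∀ t : ℤ, (2 : ℚ) ^ (t - p - 1) < (2 : ℚ) ^ t := fun t =>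
    zpow_lt_zpow_right₀ (by norm_num) (by omega)
  intro n
  induction n with
  | zero =>
    intro l hn _ _ t _
    rw [List.eq_nil_of_length_eq_zero (Nat.le_zero.mp hn), List.sum_nil, abs_zero]
    linarith [slack_pos t, zpow_pos h2 (t - p - 1)]
  | succ n ih =>
    intro l hn hlF hsns t ht
    rcases l.eq_nil_or_concat with rfl | ⟨l', x, rfl⟩
    · rw [List.sum_nil, abs_zero]; linarith [slack_pos t, zpow_pos h2 (t - p - 1)]
    simp only [List.concat_eq_append] at hn hlF hsns ht ⊢
    have hn' : l'.length ≤ n := by rw [List.length_append, List.length_singleton] at hn; omega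
    have hl'F : ∀ y ∈ l', IsFloat p emin y := fun y hy => hlF y (List.mem_append_left _ hy)
    have hxF : IsFloat p emin x := hlF x (List.mem_append_right _ (List.mem_singleton_self x))
    have hl'sns : IsStrongExpansion l' := hsns.sublist (List.sublist_append_left l' [x])
    have hl't : ∀ y ∈ l', |y| < (2 : ℚ) ^ t := fun y hy => ht y (List.mem_append_left _ hy)
    have hxt : |x| < (2 : ℚ) ^ t := ht x (List.mem_append_right _ (List.mem_singleton_self x))
    have hSB : ∀ z ∈ l', StrongBelow z x := fun z hz =>
      (List.pairwise_append.mp hsns.1).2.2 z hz x (List.mem_singleton_self x)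
    rw [List.sum_append, List.sum_singleton]
    by_cases hx0 : x = 0
    · rw [hx0, add_zero]; exact ih l' hn' hl'F hl'sns t hl't
    obtain ⟨M, v, hMo, hMp, -, hxe⟩ := exists_odd_mul_two_zpow hxF hx0
    have h2v : (0 : ℚ) < (2 : ℚ) ^ v := zpow_pos h2 _
    have hM1 : (1 : ℚ) ≤ |(M : ℚ)| := by
      have : M ≠ 0 := by rintro rfl; exact hx0 (by rw [hxe]; simp)
      rw [← Int.cast_abs]; exact_mod_cast Int.one_le_abs this
    have habsx : |x| = |(M : ℚ)| * (2 : ℚ) ^ v := by rw [hxe, abs_mul, abs_of_pos h2v]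
    have hvx : (2 : ℚ) ^ v ≤ |x| := by rw [habsx]; exact le_mul_of_one_le_left h2v.le hM1
    have hxvp : |x| < (2 : ℚ) ^ (v + p) := by
      rw [habsx, zpow_add₀ (by norm_num : (2:ℚ) ≠ 0), zpow_natCast, mul_comm]
      have : |(M : ℚ)| < 2 ^ p := by rw [← Int.cast_abs]; exact_mod_cast hMp
      exact mul_lt_mul_of_pos_left this h2v
    -- the binade of `x`: `2^T ≤ |x| < 2^(T+1)`
    set T : ℤ := Int.log 2 |x| with hT
    have hTx : (2 : ℚ) ^ T ≤ |x| := zpow_log_le_abs hx0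
    have hxT : |x| < (2 : ℚ) ^ (T + 1) := abs_lt_zpow_log_succ x
    have hvT : v ≤ T := by
      have : (2 : ℚ) ^ v < (2 : ℚ) ^ (T + 1) := lt_of_le_of_lt hvx hxT
      have := (zpow_lt_zpow_iff_right₀ (by norm_num : (1:ℚ) < 2)).mp this; omega
    have hTvp : T ≤ v + p - 1 := by
      have : (2 : ℚ) ^ T < (2 : ℚ) ^ (v + p) := lt_of_le_of_lt hTx hxvp
      have := (zpow_lt_zpow_iff_right₀ (by norm_num : (1:ℚ) < 2)).mp this; omega
    have hTt : T + 1 ≤ t := by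
      have : (2 : ℚ) ^ T < (2 : ℚ) ^ t := lt_of_le_of_lt hTx hxt
      have := (zpow_lt_zpow_iff_right₀ (by norm_num : (1:ℚ) < 2)).mp this; omega
    -- it suffices to bound by the binade-relative slack
    suffices H : |l'.sum + x| < (2 : ℚ) ^ (T + 1) - (2 : ℚ) ^ (T + 1 - p - 1) from
      lt_of_lt_of_le H (two_zpow_sub_mono p hTt)
    have hTslack : (2 : ℚ) ^ (T + 1 - p - 1) = (2 : ℚ) ^ (T - p) := by congr 1; ring
    rw [hTslack]
    -- `x` on its own grid: `|x| ≤ 2^(T+1) − 2^v`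
    have hxG : OnGrid v x := ⟨M, hxe⟩
    have hxup : |x| + (2 : ℚ) ^ v ≤ (2 : ℚ) ^ (T + 1) :=
      hxG.abs.add_two_zpow_le (OnGrid.two_zpow (by omega)) hxT
    -- components 2-below `x` are below `2^(v-1)`
    have hvm1 : (2 : ℚ) ^ v = 2 * (2 : ℚ) ^ (v - 1) := two_zpow_eq_two_mul (by ring)
    have hB2 : ∀ z, Below 2 z x → |z| < (2 : ℚ) ^ (v - 1) := by
      intro z ⟨s, hs, hlt⟩
      have hsv : s ≤ v := OnGrid.le_of_odd hMo (by rwa [hxe] at hs)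
      have : (2 : ℚ) ^ s ≤ (2 : ℚ) ^ v := zpow_le_zpow_right₀ (by norm_num) hsv
      linarith
    have htri := abs_add_le l'.sum x
    by_cases hM : |M| = 1
    · -- `x = ±2^v` is a one-bit number, `T = v`
      have habsx' : |x| = (2 : ℚ) ^ v := by
        rw [habsx, ← Int.cast_abs, hM]; simp
      have hTv : T = v := by
        have h1 : (2 : ℚ) ^ T < (2 : ℚ) ^ (v + 1) := by
          rw [zpow_add_one₀ (by norm_num : (2:ℚ) ≠ 0)]; linarith [hTx]
        have := (zpow_lt_zpow_iff_right₀ (by norm_num : (1:ℚ) < 2)).mp h1; omega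
      rw [hTv]
      have hv1 : (2 : ℚ) ^ (v + 1) = 2 * (2 : ℚ) ^ v := two_zpow_eq_two_mul (by ring)
      have hvm2 : (2 : ℚ) ^ (v - 1) = 2 * (2 : ℚ) ^ (v - 2) := two_zpow_eq_two_mul (by ring)
      -- every earlier component is `< 2^(v-1)` in magnitude or equal to `2^(v-1)`
      have hzcases : ∀ z ∈ l', |z| < (2 : ℚ) ^ (v - 1) ∨ |z| = (2 : ℚ) ^ (v - 1) := by
        intro z hz
        rcases hSB z hz with hb | ⟨a, hza, hxa⟩
        · exact Or.inl (hB2 z hb)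
        · right
          have : a + 1 = v :=
            zpow_right_injective₀ (by norm_num) (by norm_num) (hxa.symm.trans habsx')
          rw [hza]; congr 1; omega
      by_cases hy : ∃ y ∈ l', |y| = (2 : ℚ) ^ (v - 1)
      · -- Sub-case: the adjacent one-bit partner `y = ±2^(v-1)` is present
        obtain ⟨y, hyl, hya⟩ := hy
        obtain ⟨A, B, hAB⟩ := List.append_of_mem hyl
        have hy0 : y ≠ 0 := by
          intro h0; rw [h0, abs_zero] at hya; exact (zpow_pos h2 _).ne hya
        have hsubl : (A ++ B).Sublist l' := by
          rw [hAB]; exact (List.Sublist.refl A).append (List.sublist_cons_self y B)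
        have hABn : (A ++ B).length ≤ n := by
          have h1 : l'.length = A.length + B.length + 1 := by
            rw [hAB, List.length_append, List.length_cons]; omega
          rw [List.length_append]; omega
        have hABF : ∀ z ∈ A ++ B, IsFloat p emin z := fun z hz => hl'F z (hsubl.subset hz)
        have hABsns : IsStrongExpansion (A ++ B) := hl'sns.sublist hsubl
        -- components other than `y` are below `2^(v-2)`
        have hpw := hl'sns.1
        rw [hAB, List.pairwise_append, List.pairwise_cons] at hpw
        have hABlt : ∀ z ∈ A ++ B, |z| < (2 : ℚ) ^ (v - 2) := by
          intro z hz
          rcases List.mem_append.mp hz with hzA | hzB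
          · -- `z` precedes `y`: strongly below `y = ±2^(v-1)`, and not its adjacent partner
            have hzy : StrongBelow z y := hpw.2.2 z hzA y List.mem_cons_self
            rcases hzy with ⟨s, hs, hlt⟩ | ⟨a, hza, hya'⟩
            · -- `y = ±1·2^(v-1)` is an odd multiple: `s ≤ v - 1`
              have hyodd : ∃ u : ℤ, Odd u ∧ y = (u : ℚ) * (2 : ℚ) ^ (v - 1) := by
                rcases (abs_eq (zpow_nonneg h2.le (v - 1))).mp hya with h | h
                · exact ⟨1, odd_one, by rw [h]; simp⟩
                · exact ⟨-1, by decide, by rw [h]; simp⟩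
              obtain ⟨u, hu, hyu⟩ := hyodd
              have hsv : s ≤ v - 1 := OnGrid.le_of_odd hu (by rwa [hyu] at hs)
              have : (2 : ℚ) ^ s ≤ (2 : ℚ) ^ (v - 1) := zpow_le_zpow_right₀ (by norm_num) hsv
              linarith
            · -- adjacent partner below `y`: then `y` is adjacent to two components
              exfalso
              have ha : a + 1 = v - 1 :=
                zpow_right_injective₀ (by norm_num) (by norm_num) (hya'.symm.trans hya)
              refine hsns.2 y (List.mem_append_left _ hyl) hy0 ?_ ?_
              · refine List.mem_map.mpr ⟨z, List.mem_append_left _ (hsubl.subset hz), ?_⟩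
                rw [hza, hya, hvm2]; have : a = v - 2 := by omega
                rw [this]; ring
              · refine List.mem_map.mpr
                  ⟨x, List.mem_append_right _ (List.mem_singleton_self x), ?_⟩
                rw [habsx', hya, hvm1]
          · -- `z` follows `y` inside `l'`: it would have to exceed `|y|`, impossible below `x`
            have hyz : StrongBelow y z := hpw.2.1.1 z hzB
            by_cases hz0 : z = 0
            · rw [hz0, abs_zero]; exact zpow_pos h2 _
            · exfalso
              have h1 : |y| < |z| := hyz.abs_lt hz0
              rcases hzcases z (hsubl.subset hz) with hlt | heq
              · linarith
              · linarith
        have hIH := ih (A ++ B) hABn hABF hABsns (v - 2) hABlt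
        have hsumAB : l'.sum = y + (A ++ B).sum := by
          rw [hAB, List.sum_append, List.sum_cons, List.sum_append]; ring
        have hslack : (2 : ℚ) ^ (v - p) ≤ (2 : ℚ) ^ (v - 2) :=
          zpow_le_zpow_right₀ (by norm_num) (by omega)
        have hslack2 : (0 : ℚ) < (2 : ℚ) ^ (v - 2 - p - 1) := zpow_pos h2 _
        have htri2 := abs_add_le y (A ++ B).sum
        rw [hsumAB] at htri ⊢
        calc |y + (A ++ B).sum + x| ≤ |y + (A ++ B).sum| + |x| := abs_add_le _ _
          _ ≤ |y| + |(A ++ B).sum| + |x| := by linarith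
          _ < (2 : ℚ) ^ (v + 1) - (2 : ℚ) ^ (v - p) := by
            rw [hya, habsx', hv1, hvm1, hvm2]; linarith
      · -- Sub-case: no adjacent partner: everything earlier is below `2^(v-1)`
        push Not at hy
        have hl'lt : ∀ z ∈ l', |z| < (2 : ℚ) ^ (v - 1) := fun z hz' =>
          (hzcases z hz').resolve_right (hy z hz')
        have hIH := ih l' hn' hl'F hl'sns (v - 1) hl'lt
        have hslack2 : (0 : ℚ) < (2 : ℚ) ^ (v - 1 - p - 1) := zpow_pos h2 _
        have hsl1 : (2 : ℚ) ^ (v - p) ≤ (2 : ℚ) ^ (v - 1) :=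
          zpow_le_zpow_right₀ (by norm_num) (by omega)
        calc |l'.sum + x| ≤ |l'.sum| + |x| := htri
          _ < (2 : ℚ) ^ (v + 1) - (2 : ℚ) ^ (v - p) := by rw [habsx', hv1, hvm1]; linarith
    · -- `x` is not a one-bit number: every earlier component lies 2-below it
      have hl'lt : ∀ z ∈ l', |z| < (2 : ℚ) ^ (v - 1) := by
        intro z hz
        rcases hSB z hz with hb | ⟨a, -, hxa⟩
        · exact hB2 z hb
        · exfalso
          rw [hxe] at hxa
          exact hM (abs_eq_one_of_odd_of_abs_eq_two_zpow hMo hxa).1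
      have hIH := ih l' hn' hl'F hl'sns (v - 1) hl'lt
      have hslack2 : (0 : ℚ) < (2 : ℚ) ^ (v - 1 - p - 1) := zpow_pos h2 _
      have hsl1 : (2 : ℚ) ^ (T - p) ≤ (2 : ℚ) ^ (v - 1) :=
        zpow_le_zpow_right₀ (by norm_num) (by omega)
      calc |l'.sum + x| ≤ |l'.sum| + |x| := htri
        _ < (2 : ℚ) ^ (T + 1) - (2 : ℚ) ^ (T - p) := by linarith


/-- **LEMMA 15.** "Let `ĝ = Σ ĝⱼ` be a series formed by merging two strongly nonoverlapping
expansions, or a subseries thereof. Suppose that `ĝ_k` is the largest component and has a nonzero bit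
of magnitude `2^i` or smaller for some integer `i`. Then `|Σ_{j=1}^{k} ĝⱼ| < 2^i(2^{p+1} − 1)`, and
`|Σ_{j=1}^{k−1} ĝⱼ| < 2^i(2^p)`."  Here the two merged (sub)expansions are `ea ++ [x]` and `fb`
(`x = ĝ_k` the largest summand; "has a nonzero bit of magnitude `2^i` or smaller" = `x ∉ 2^(i+1)·ℤ`);
any `p ≥ 2` (printed: `p ≥ 4` is only used by Theorem 13). [cite: Shewchuk1997, Lemma 15 p. 320–321] -/
theorem lemma15 (hp : 2 ≤ p) {ea fb : List ℚ} {x : ℚ}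
    (heF : ∀ y ∈ ea ++ [x], IsFloat p emin y) (hes : IsStrongExpansion (ea ++ [x]))
    (hfF : ∀ y ∈ fb, IsFloat p emin y) (hfs : IsStrongExpansion fb)
    (hle : ∀ y ∈ fb, |y| ≤ |x|) {i : ℤ} (hi : ¬ OnGrid (i + 1) x) :
    |ea.sum + x + fb.sum| < (2 : ℚ) ^ i * (2 ^ (p + 1) - 1) ∧
      |ea.sum + fb.sum| < (2 : ℚ) ^ (i + p) := by
  have h2 : (0 : ℚ) < 2 := by norm_num
  have hx0 : x ≠ 0 := fun h0 => hi (h0 ▸ OnGrid.zero _)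
  have hxF : IsFloat p emin x := heF x (List.mem_append_right _ (List.mem_singleton_self x))
  have heaF : ∀ y ∈ ea, IsFloat p emin y := fun y hy => heF y (List.mem_append_left _ hy)
  have heas : IsStrongExpansion ea := hes.sublist (List.sublist_append_left ea [x])
  have hSB : ∀ z ∈ ea, StrongBelow z x := fun z hz =>
    (List.pairwise_append.mp hes.1).2.2 z hz x (List.mem_singleton_self x)
  obtain ⟨M, v, hMo, hMp, -, hxe⟩ := exists_odd_mul_two_zpow hxF hx0
  have h2v : (0 : ℚ) < (2 : ℚ) ^ v := zpow_pos h2 _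
  have hvi : v ≤ i := by
    by_contra hlt
    exact hi ((show OnGrid v x from ⟨M, hxe⟩).mono (by omega))
  have hM1 : (1 : ℚ) ≤ |(M : ℚ)| := by
    have : M ≠ 0 := by rintro rfl; exact hx0 (by rw [hxe]; simp)
    rw [← Int.cast_abs]; exact_mod_cast Int.one_le_abs this
  have habsx : |x| = |(M : ℚ)| * (2 : ℚ) ^ v := by rw [hxe, abs_mul, abs_of_pos h2v]
  have hvx : (2 : ℚ) ^ v ≤ |x| := by rw [habsx]; exact le_mul_of_one_le_left h2v.le hM1
  have hxvp : |x| < (2 : ℚ) ^ (v + p) := by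
    rw [habsx, zpow_add₀ (by norm_num : (2:ℚ) ≠ 0), zpow_natCast, mul_comm]
    have : |(M : ℚ)| < 2 ^ p := by rw [← Int.cast_abs]; exact_mod_cast hMp
    exact mul_lt_mul_of_pos_left this h2v
  set T : ℤ := Int.log 2 |x| with hT
  have hTx : (2 : ℚ) ^ T ≤ |x| := zpow_log_le_abs hx0
  have hxT : |x| < (2 : ℚ) ^ (T + 1) := abs_lt_zpow_log_succ x
  have hTvp : T ≤ v + p - 1 := by
    have : (2 : ℚ) ^ T < (2 : ℚ) ^ (v + p) := lt_of_le_of_lt hTx hxvp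
    have := (zpow_lt_zpow_iff_right₀ (by norm_num : (1:ℚ) < 2)).mp this; omega
  have hTip : T + 1 ≤ i + p := by omega
  -- the strongly-nonoverlapping sum bound for `fb` and for `ea ++ [x]`
  have hG := abs_sum_lt_of_isStrongExpansion (emin := emin) hp
  have hmono := two_zpow_sub_mono p hTip
  have hslack : (2 : ℚ) ^ (i + p - p - 1) = (2 : ℚ) ^ (i - 1) := by congr 1; ring
  rw [hslack] at hmono
  have hfb : |fb.sum| < (2 : ℚ) ^ (i + p) - (2 : ℚ) ^ (i - 1) :=
    lt_of_lt_of_le (hG fb.length fb le_rfl hfF hfs (T + 1)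
      (fun y hy => lt_of_le_of_lt (hle y hy) hxT)) hmono
  have hex : |(ea ++ [x]).sum| < (2 : ℚ) ^ (i + p) - (2 : ℚ) ^ (i - 1) := by
    refine lt_of_lt_of_le (hG _ (ea ++ [x]) le_rfl heF hes (T + 1) fun y hy => ?_) hmono
    rcases List.mem_append.mp hy with hy | hy
    · exact lt_trans ((hSB y hy).abs_lt hx0) hxT
    · rw [List.mem_singleton.mp hy]; exact hxT
  rw [List.sum_append, List.sum_singleton] at hex
  have hip : (2 : ℚ) ^ (i + p) = (2 : ℚ) ^ (i - 1) * 2 ^ (p + 1) := by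
    rw [← zpow_natCast, ← zpow_add₀ (by norm_num : (2:ℚ) ≠ 0)]; congr 1; push_cast; ring
  have hi1 : (2 : ℚ) ^ i = 2 * (2 : ℚ) ^ (i - 1) := two_zpow_eq_two_mul (by ring)
  constructor
  · -- (1): the full partial sum
    calc |ea.sum + x + fb.sum| ≤ |ea.sum + x| + |fb.sum| := abs_add_le _ _
      _ < 2 * ((2 : ℚ) ^ (i + p) - (2 : ℚ) ^ (i - 1)) := by linarith
      _ = (2 : ℚ) ^ i * (2 ^ (p + 1) - 1) := by rw [hip, hi1]; ring
  · -- (2): the partial sum without the largest summand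
    have hvm1 : (2 : ℚ) ^ v = 2 * (2 : ℚ) ^ (v - 1) := two_zpow_eq_two_mul (by ring)
    have hvi1 : (2 : ℚ) ^ (v - 1) ≤ (2 : ℚ) ^ (i - 1) :=
      zpow_le_zpow_right₀ (by norm_num) (by omega)
    by_cases hM : |M| = 1
    · -- `x = ±2^v`: `|Σ ea| < 2^v`, `|Σ fb| < 2^(v+1)`, total `< 3·2^v < 2^(i+p)`
      have habsx' : |x| = (2 : ℚ) ^ v := by rw [habsx, ← Int.cast_abs, hM]; simp
      have hea : |ea.sum| < (2 : ℚ) ^ v :=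
        abs_sum_lt_two_zpow_of_isExpansion heaF heas.isExpansion fun z hz =>
          habsx' ▸ (hSB z hz).abs_lt hx0
      have hfb' : |fb.sum| < (2 : ℚ) ^ (v + 1) :=
        abs_sum_lt_two_zpow_of_isExpansion hfF hfs.isExpansion fun y hy => by
          have := hle y hy; rw [habsx'] at this
          exact lt_of_le_of_lt this (zpow_lt_zpow_right₀ (by norm_num) (by omega))
      have hv1 : (2 : ℚ) ^ (v + 1) = 2 * (2 : ℚ) ^ v := two_zpow_eq_two_mul (by ring)
      have hv2 : (2 : ℚ) ^ (v + 2) = 2 * (2 : ℚ) ^ (v + 1) := two_zpow_eq_two_mul (by ring)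
      have hvip : (2 : ℚ) ^ (v + 2) ≤ (2 : ℚ) ^ (i + p) :=
        zpow_le_zpow_right₀ (by norm_num) (by omega)
      calc |ea.sum + fb.sum| ≤ |ea.sum| + |fb.sum| := abs_add_le _ _
        _ < (2 : ℚ) ^ (i + p) := by linarith
    · -- `x` not a one-bit number: everything in `ea` lies 2-below `x`, so `|Σ ea| < 2^(v-1)`
      have hlt : ∀ z ∈ ea, |z| < (2 : ℚ) ^ (v - 1) := by
        intro z hz
        rcases hSB z hz with ⟨s, hs, hlt⟩ | ⟨a, -, hxa⟩
        · have hsv : s ≤ v := OnGrid.le_of_odd hMo (by rwa [hxe] at hs)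
          have : (2 : ℚ) ^ s ≤ (2 : ℚ) ^ v := zpow_le_zpow_right₀ (by norm_num) hsv
          linarith
        · exfalso; rw [hxe] at hxa
          exact hM (abs_eq_one_of_odd_of_abs_eq_two_zpow hMo hxa).1
      have hea : |ea.sum| < (2 : ℚ) ^ (v - 1) :=
        abs_sum_lt_two_zpow_of_isExpansion heaF heas.isExpansion hlt
      calc |ea.sum + fb.sum| ≤ |ea.sum| + |fb.sum| := abs_add_le _ _
        _ < (2 : ℚ) ^ (i + p) := by linarith

/-! ### §2.4 FAST-EXPANSION-SUM (Theorem 13) -/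

/-- **Line 1 of FAST-EXPANSION-SUM**: "Merge `e` and `f` into a single sequence `g`, in order of
nondecreasing magnitude (possibly with interspersed zeros)" — the standard stable merge by `|·|`
(on a tie the component of `e` goes first). [cite: Shewchuk1997, Thm 13 p. 320 (algorithm, Line 1)] -/
def mergeExpansions (e f : List ℚ) : List ℚ :=
  List.merge e f (fun a b => decide (|a| ≤ |b|))

/-- Merging with an empty expansion. [cite: Shewchuk1997, Thm 13 p. 320 (algorithm, Line 1)] -/
@[simp] theorem mergeExpansions_nil_left (f : List ℚ) : mergeExpansions [] f = f :=
  List.nil_merge _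

/-- Merging with an empty expansion. [cite: Shewchuk1997, Thm 13 p. 320 (algorithm, Line 1)] -/
@[simp] theorem mergeExpansions_nil_right (e : List ℚ) : mergeExpansions e [] = e :=
  List.merge_right _

/-- One comparison of the merge. [cite: Shewchuk1997, Thm 13 p. 320 (algorithm, Line 1)] -/
theorem mergeExpansions_cons_cons (x y : ℚ) (xs ys : List ℚ) :
    mergeExpansions (x :: xs) (y :: ys) =
      if |x| ≤ |y| then x :: mergeExpansions xs (y :: ys) else y :: mergeExpansions (x :: xs) ys := by
  unfold mergeExpansions
  rw [List.cons_merge_cons]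
  by_cases h : |x| ≤ |y| <;> simp [h]

/-- `g` has `m + n` components. [cite: Shewchuk1997, Thm 13 p. 319] -/
theorem length_mergeExpansions (e f : List ℚ) :
    (mergeExpansions e f).length = e.length + f.length :=
  List.length_merge _ _ _

/-- The components of `g` are the components of `e` and of `f`. [cite: Shewchuk1997, Thm 13 p. 320] -/
theorem mem_mergeExpansions {e f : List ℚ} {x : ℚ} : x ∈ mergeExpansions e f ↔ x ∈ e ∨ x ∈ f :=
  List.mem_merge

/-- `g` is a rearrangement of `e ++ f`; in particular `Σ gᵢ = e + f`.
[cite: Shewchuk1997, Thm 13 p. 320; Lemma 14 p. 320] -/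
theorem mergeExpansions_perm (e f : List ℚ) : (mergeExpansions e f).Perm (e ++ f) :=
  List.merge_perm_append _

/-- Where the head of the merge comes from: the head of `e` (not exceeding the head of `f` in
magnitude) or the head of `f` (strictly smaller in magnitude than the head of `e`).
[cite: Shewchuk1997, Thm 13 p. 320 (algorithm, Line 1)] -/
theorem mergeExpansions_eq_cons {e f rs : List ℚ} {z : ℚ} (h : mergeExpansions e f = z :: rs) :
    (∃ e', e = z :: e' ∧ rs = mergeExpansions e' f ∧ ∀ y ys, f = y :: ys → |z| ≤ |y|) ∨
      (∃ f', f = z :: f' ∧ rs = mergeExpansions e f' ∧ ∀ x xs, e = x :: xs → |z| < |x|) := by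
  cases e with
  | nil =>
    right
    rw [mergeExpansions_nil_left] at h
    exact ⟨rs, h, by simp, fun x xs hx => by simp at hx⟩
  | cons x xs =>
    cases f with
    | nil =>
      left
      rw [mergeExpansions_nil_right] at h
      obtain ⟨rfl, rfl⟩ := List.cons.inj h
      exact ⟨xs, rfl, by simp, fun y ys hy => by simp at hy⟩
    | cons y ys =>
      rw [mergeExpansions_cons_cons] at h
      by_cases hxy : |x| ≤ |y|
      · rw [if_pos hxy] at h
        obtain ⟨rfl, rfl⟩ := List.cons.inj h
        left
        refine ⟨xs, rfl, rfl, fun y' ys' hy => ?_⟩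
        obtain ⟨rfl, -⟩ := List.cons.inj hy
        exact hxy
      · rw [if_neg hxy] at h
        obtain ⟨rfl, rfl⟩ := List.cons.inj h
        right
        refine ⟨ys, rfl, rfl, fun x' xs' hx => ?_⟩
        obtain ⟨rfl, -⟩ := List.cons.inj hx
        exact lt_of_not_ge hxy

/-- In the merge of two lists each sorted by magnitude except for zeros, the first component does not
exceed the second in magnitude unless the second is zero (so Line 2 may use FAST-TWO-SUM).
[cite: Shewchuk1997, Thm 13 p. 320 (algorithm, Lines 1–2)] -/
theorem mergeExpansions_head_le {e f gs : List ℚ} {g₁ g₂ : ℚ}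
    (he : e.Pairwise fun a b => b ≠ 0 → |a| ≤ |b|) (hf : f.Pairwise fun a b => b ≠ 0 → |a| ≤ |b|)
    (h : mergeExpansions e f = g₁ :: g₂ :: gs) (hg₂ : g₂ ≠ 0) : |g₁| ≤ |g₂| := by
  rcases mergeExpansions_eq_cons h with ⟨e', rfl, hrs, hhead⟩ | ⟨f', rfl, hrs, hhead⟩
  · rcases mergeExpansions_eq_cons hrs.symm with ⟨e'', rfl, -, -⟩ | ⟨f'', rfl, -, -⟩
    · exact (List.pairwise_cons.mp he).1 g₂ List.mem_cons_self hg₂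
    · exact hhead g₂ f'' rfl
  · rcases mergeExpansions_eq_cons hrs.symm with ⟨e'', rfl, -, -⟩ | ⟨f'', rfl, -, -⟩
    · exact (hhead g₂ e'' rfl).le
    · exact (List.pairwise_cons.mp hf).1 g₂ List.mem_cons_self hg₂

/-- **FAST-EXPANSION-SUM(e, f)** (p. 320; Fig. 8 shows it at work): `1. merge e and f into g`; `2. (Q₂, h₁) ⇐
FAST-TWO-SUM(g₂, g₁)`; `3–4. for i ⇐ 3 to m + n: (Qᵢ, hᵢ₋₁) ⇐ TWO-SUM(Qᵢ₋₁, gᵢ)`;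
`5. h_{m+n} ⇐ Q_{m+n}`; `6. return h`.  Lines 3–5 are literally GROW-EXPANSION of `⟨g₃, …⟩` by
`Q₂`.  (For fewer than two components in total the loop is empty and `h = g`.)
[cite: Shewchuk1997, Thm 13 p. 319–320 (algorithm p. 320)] -/
def fastExpansionSum (fl : ℚ → ℚ) (e f : List ℚ) : List ℚ :=
  match mergeExpansions e f with
  | [] => []
  | [g₁] => [g₁]
  | g₁ :: g₂ :: gs => (fastTwoSum fl g₂ g₁).2 :: growExpansion fl gs (fastTwoSum fl g₂ g₁).1

/-- Line 2, `FAST-TWO-SUM(g₂, g₁)` with `|g₁| ≤ |g₂|` or `g₂ = 0` (floats), returns the same pair as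
`TWO-SUM(g₁, g₂)` would: "Line 2 and TWO-SUM both are exact" (Theorems 6 and 7), and for `g₂ = 0`
both return `(g₁, 0)`. [cite: Shewchuk1997, Thm 13 p. 320; Thm 6 p. 312; Thm 7 p. 314] -/
theorem fastTwoSum_eq_twoSum_of_abs_le (hp : 1 ≤ p) (hfl : IsRoundNearest p emin fl) {g₁ g₂ : ℚ}
    (h₁ : IsFloat p emin g₁) (h₂ : IsFloat p emin g₂) (h : |g₁| ≤ |g₂| ∨ g₂ = 0) :
    fastTwoSum fl g₂ g₁ = twoSum fl g₁ g₂ := by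
  rcases h with h | rfl
  · obtain ⟨hf1, -, hf2, -⟩ := fastTwoSum_exact hp hfl h₂ h₁ h
    obtain ⟨ht2, -⟩ := twoSum_exact hp hfl h₁ h₂
    refine Prod.ext ?_ ?_
    · rw [hf1, twoSum_fst, add_comm]
    · rw [hf2, ht2, add_comm]
  · rw [twoSum_zero_right hfl h₁]
    have h0 : fl 0 = 0 := fl_zero hfl
    have hg : fl g₁ = g₁ := fl_eq_self hfl h₁
    show (fl (0 + g₁), fl (g₁ - fl (fl (0 + g₁) - 0))) = (g₁, 0)
    rw [zero_add, hg, sub_zero, hg, sub_self, h0]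

/-- `TWO-SUM(0, b) = (b, 0)` for a float `b` (the pipeline-delay identity for a zero accumulator).
[cite: Shewchuk1997, §2.4 p. 316–317; Thm 7 p. 314] -/
theorem twoSum_zero_left (hfl : IsRoundNearest p emin fl) {b : ℚ} (hb : IsFloat p emin b) :
    twoSum fl 0 b = (b, 0) := by
  have h0 : fl 0 = 0 := fl_zero hfl
  have hb' : fl b = b := fl_eq_self hfl hb
  show (fl (0 + b), fl (fl (0 - fl (fl (0 + b) - fl (fl (0 + b) - 0))) +
      fl (b - fl (fl (0 + b) - 0)))) = (b, 0)
  rw [zero_add, hb', sub_zero, hb', sub_self, h0, sub_zero, h0, add_zero, h0]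

/-- FAST-EXPANSION-SUM is GROW-EXPANSION of `⟨g₂, g₃, …⟩` by `g₁` whenever Line 2's FAST-TWO-SUM is
legitimate (`|g₁| ≤ |g₂|` or `g₂ = 0`), in particular for inputs sorted by magnitude except zeros.
[cite: Shewchuk1997, Thm 13 p. 320 (algorithm)] -/
theorem fastExpansionSum_eq_growExpansion (hp : 1 ≤ p) (hfl : IsRoundNearest p emin fl)
    {e f : List ℚ} (heF : ∀ x ∈ e, IsFloat p emin x) (hfF : ∀ x ∈ f, IsFloat p emin x)
    (he : e.Pairwise fun a b => b ≠ 0 → |a| ≤ |b|) (hf : f.Pairwise fun a b => b ≠ 0 → |a| ≤ |b|)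
    {g₁ : ℚ} {gs : List ℚ} (h : mergeExpansions e f = g₁ :: gs) :
    fastExpansionSum fl e f = growExpansion fl gs g₁ := by
  have hgF : ∀ x ∈ mergeExpansions e f, IsFloat p emin x := fun x hx =>
    (mem_mergeExpansions.mp hx).elim (heF x) (hfF x)
  rw [h] at hgF
  cases gs with
  | nil => simp [fastExpansionSum, h]
  | cons g₂ gs =>
    have h₁ : IsFloat p emin g₁ := hgF g₁ List.mem_cons_self
    have h₂ : IsFloat p emin g₂ := hgF g₂ (List.mem_cons_of_mem _ List.mem_cons_self)
    have hle : |g₁| ≤ |g₂| ∨ g₂ = 0 := by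
      by_cases hg₂ : g₂ = 0
      · exact Or.inr hg₂
      · exact Or.inl (mergeExpansions_head_le he hf h hg₂)
    simp only [fastExpansionSum, h, growExpansion_cons,
      fastTwoSum_eq_twoSum_of_abs_le hp hfl h₁ h₂ hle]

/-- A strongly nonoverlapping expansion is sorted by magnitude except for zeros.
[cite: Shewchuk1997, §2.4 p. 318–319] -/
theorem IsStrongExpansion.pairwise_abs_le {l : List ℚ} (h : IsStrongExpansion l) :
    l.Pairwise fun a b => b ≠ 0 → |a| ≤ |b| :=
  h.1.imp fun hab hb => (hab.abs_lt hb).le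

/-- **LEMMA 14 (Q Invariant)**, summed to the end: "at the end of each iteration of the for loop, the
invariant `Qᵢ + Σ_{j=1}^{i−1} hⱼ = Σ_{j=1}^{i} gⱼ` holds ... assures us that after Line 5 is executed,
`Σ_{j=1}^{m+n} hⱼ = Σ_{j=1}^{m+n} gⱼ`, so the algorithm produces a correct sum" — for ANY
round-to-nearest and any float inputs sorted by magnitude except zeros (in particular strongly
nonoverlapping ones). [cite: Shewchuk1997, Lemma 14 p. 320] -/
theorem sum_fastExpansionSum (hp : 1 ≤ p) (hfl : IsRoundNearest p emin fl) {e f : List ℚ}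
    (heF : ∀ x ∈ e, IsFloat p emin x) (hfF : ∀ x ∈ f, IsFloat p emin x)
    (he : e.Pairwise fun a b => b ≠ 0 → |a| ≤ |b|) (hf : f.Pairwise fun a b => b ≠ 0 → |a| ≤ |b|) :
    (fastExpansionSum fl e f).sum = e.sum + f.sum := by
  have hgF : ∀ x ∈ mergeExpansions e f, IsFloat p emin x := fun x hx =>
    (mem_mergeExpansions.mp hx).elim (heF x) (hfF x)
  have hsum : (mergeExpansions e f).sum = e.sum + f.sum := by
    rw [(mergeExpansions_perm e f).sum_eq, List.sum_append]
  rcases hm : mergeExpansions e f with _ | ⟨g₁, gs⟩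
  · have : fastExpansionSum fl e f = [] := by simp [fastExpansionSum, hm]
    rw [this, ← hsum, hm]
  · rw [fastExpansionSum_eq_growExpansion hp hfl heF hfF he hf hm,
      sum_growExpansion hp hfl (hgF g₁ (hm ▸ List.mem_cons_self))
        (fun x hx => hgF x (hm ▸ List.mem_cons_of_mem _ hx)), ← hsum, hm, List.sum_cons]

/-! #### The induction behind Lemma 16 / Theorem 13 -/

/-- The INDUCTION INVARIANT of the proof of Theorem 13 (state after some iterations of Lines 2–4):
the inputs split as processed ++ unprocessed (`e = e₁ ++ e₂`, `f = f₁ ++ f₂`, the processed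
components being the smallest: "`ê` and `f̂` be the smallest `i − 1` components of `g`"), the
accumulator `Q` is a float with `Q + Σ hs = Σ e₁ + Σ f₁` (Lemma 14), the outputs so far `hs` are
floats forming a nonoverlapping increasing expansion, and — the formal content of "`g_{i+1}` ... are
of the form `±∗0`", "`±∗00`" — there is ONE grid `2^g ⊇ {Q} ∪ e₂ ∪ f₂` lying above every output
(`|h| < 2^g` for `h ∈ hs`). [cite: Shewchuk1997, Thm 13 p. 322–323 (proof); Lemma 14 p. 320] -/
structure FesInv (p : ℕ) (emin : ℤ) (e f e₁ f₁ e₂ f₂ : List ℚ) (Q : ℚ) (hs : List ℚ) (g : ℤ) :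
    Prop where
  he : e = e₁ ++ e₂
  hf : f = f₁ ++ f₂
  hQ : IsFloat p emin Q
  hsum : Q + hs.sum = e₁.sum + f₁.sum
  hle : ∀ y ∈ e₁ ++ f₁, ∀ x ∈ e₂ ++ f₂, x ≠ 0 → |y| ≤ |x|
  hhs : ∀ h ∈ hs, IsFloat p emin h
  hexp : IsExpansion 1 hs
  hg : emin ≤ g
  hQg : OnGrid g Q
  hrg : ∀ x ∈ e₂ ++ f₂, OnGrid g x
  hhg : ∀ h ∈ hs, |h| < (2 : ℚ) ^ g

/-- The invariant is symmetric in the two input expansions.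
[cite: Shewchuk1997, Thm 13 p. 322 (proof)] -/
theorem FesInv.swap {e f e₁ f₁ e₂ f₂ : List ℚ} {Q : ℚ} {hs : List ℚ} {g : ℤ}
    (hI : FesInv p emin e f e₁ f₁ e₂ f₂ Q hs g) : FesInv p emin f e f₁ e₁ f₂ e₂ Q hs g where
  he := hI.hf
  hf := hI.he
  hQ := hI.hQ
  hsum := by rw [hI.hsum, add_comm]
  hle := fun y hy x hx => hI.hle y (by rw [List.mem_append] at hy ⊢; tauto) x
    (by rw [List.mem_append] at hx ⊢; tauto)
  hhs := hI.hhs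
  hexp := hI.hexp
  hg := hI.hg
  hQg := hI.hQg
  hrg := fun x hx => hI.hrg x (by rw [List.mem_append] at hx ⊢; tauto)
  hhg := hI.hhg

/-- The initial state (nothing processed, `Q = 0`, common grid `2^emin`).
[cite: Shewchuk1997, Thm 13 p. 322 (proof)] -/
theorem FesInv.init {e f : List ℚ} (heF : ∀ x ∈ e, IsFloat p emin x)
    (hfF : ∀ x ∈ f, IsFloat p emin x) : FesInv p emin e f [] [] e f 0 [] emin where
  he := rfl
  hf := rfl
  hQ := ⟨0, emin, by positivity, le_rfl, by simp⟩
  hsum := by simp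
  hle := fun y hy => by simp at hy
  hhs := fun h hh => by simp at hh
  hexp := isExpansion_nil 1
  hg := le_rfl
  hQg := OnGrid.zero emin
  hrg := fun x hx => (List.mem_append.mp hx).elim (fun hx => OnGrid.of_isFloat (heF x hx))
    fun hx => OnGrid.of_isFloat (hfF x hx)
  hhg := fun h hh => by simp at hh

/-- **ONE ITERATION (Lines 3–4), the heart of the proofs of Lemma 16 and Theorem 13**: processing the
next component `z` (here: the head of the unprocessed part of `e`, not exceeding the unprocessed
nonzero components of `f`) by `(Q', h) ⇐ TWO-SUM(Q, z)` re-establishes the invariant on the finer of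
the two grids `2^g` and `2·2^⌊log₂|h|⌋`: the error `h` lies below `Q'` (Theorem 7), and every
remaining input is a multiple of `2^(⌊log₂|h|⌋+1)` — else, that input having "a nonzero bit of
magnitude `2^i` or smaller" with `2^i ≤ |h|`, Lemma 15 bounds `|Σê + Σf̂| < 2^i·2^p` and the
nonoverlapping outputs give `|Σ hs| < 2^i`, so `|Q + z| < 2^i(2^p + 1)`, contradicting
Corollary 8(a). [cite: Shewchuk1997, Lemma 16 p. 321; Thm 13 p. 322–323 (proof)] -/
theorem FesInv.step (hp : 2 ≤ p) (hfl : IsRoundNearest p emin fl)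
    {e f e₁ f₁ e₂' f₂ : List ℚ} {z Q : ℚ} {hs : List ℚ} {g : ℤ}
    (heF : ∀ x ∈ e, IsFloat p emin x) (hes : IsStrongExpansion e)
    (hfF : ∀ x ∈ f, IsFloat p emin x) (hfs : IsStrongExpansion f)
    (hI : FesInv p emin e f e₁ f₁ (z :: e₂') f₂ Q hs g) (hzle : ∀ x ∈ f₂, x ≠ 0 → |z| ≤ |x|) :
    ∃ g' : ℤ, FesInv p emin e f (e₁ ++ [z]) f₁ e₂' f₂ (twoSum fl Q z).1
      (hs ++ [(twoSum fl Q z).2]) g' ∧ |(twoSum fl Q z).2| < (2 : ℚ) ^ g' := by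
  have hp1 : 1 ≤ p := le_trans (by norm_num) hp
  have h2 : (0 : ℚ) < 2 := by norm_num
  have hze : z ∈ e := by rw [hI.he]; exact List.mem_append_right _ List.mem_cons_self
  have hzF : IsFloat p emin z := heF z hze
  set Q' : ℚ := (twoSum fl Q z).1 with hQ'def
  set h : ℚ := (twoSum fl Q z).2 with hhdef
  have hQ'F : IsFloat p emin Q' := (isFloat_twoSum hfl Q z).1
  have hhF : IsFloat p emin h := (isFloat_twoSum hfl Q z).2
  obtain ⟨hh_eq, hQh⟩ := twoSum_exact hp1 hfl hI.hQ hzF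
  rw [← hhdef] at hh_eq hQh
  rw [← hQ'def] at hQh
  have hQ'eq : Q' = fl (Q + z) := twoSum_fst fl Q z
  -- bookkeeping valid in both cases
  have he' : e = (e₁ ++ [z]) ++ e₂' := by rw [hI.he]; simp
  have hsum' : Q' + (hs ++ [h]).sum = (e₁ ++ [z]).sum + f₁.sum := by
    rw [List.sum_append, List.sum_singleton, List.sum_append, List.sum_singleton]
    have := hI.hsum
    linear_combination hQh + this
  have hSBz : ∀ x ∈ e₂', StrongBelow z x := by
    have hpw := hes.1
    rw [hI.he, List.pairwise_append, List.pairwise_cons] at hpw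
    exact hpw.2.1.1
  have hsub : ∀ x ∈ e₂' ++ f₂, x ∈ (z :: e₂') ++ f₂ := fun x hx =>
    (List.mem_append.mp hx).elim (fun hx => List.mem_append_left _ (List.mem_cons_of_mem _ hx))
      fun hx => List.mem_append_right _ hx
  have hle' : ∀ y ∈ (e₁ ++ [z]) ++ f₁, ∀ x ∈ e₂' ++ f₂, x ≠ 0 → |y| ≤ |x| := by
    intro y hy x hx hx0
    rcases List.mem_append.mp hy with hy | hy
    · rcases List.mem_append.mp hy with hy | hy
      · exact hI.hle y (List.mem_append_left _ hy) x (hsub x hx) hx0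
      · rw [List.mem_singleton.mp hy]
        rcases List.mem_append.mp hx with hx | hx
        · exact ((hSBz x hx).abs_lt hx0).le
        · exact hzle x hx hx0
    · exact hI.hle y (List.mem_append_right _ hy) x (hsub x hx) hx0
  have hhs' : ∀ x ∈ hs ++ [h], IsFloat p emin x := by
    intro x hx
    rcases List.mem_append.mp hx with hx | hx
    · exact hI.hhs x hx
    · rw [List.mem_singleton.mp hx]; exact hhF
  have hQzg : OnGrid g (Q + z) :=
    hI.hQg.add (hI.hrg z (List.mem_append_left _ List.mem_cons_self))
  have hQ'g : OnGrid g Q' := by rw [hQ'eq]; exact hQzg.fl_of hp1 hfl hI.hg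
  have hhg : OnGrid g h := by rw [hh_eq]; exact hQzg.sub (hQ'eq ▸ hQ'g)
  by_cases hh0 : h = 0
  · -- a zero output: nothing moves ("pipeline delay")
    refine ⟨g, ⟨he', hI.hf, hQ'F, hsum', hle', hhs', ?_, hI.hg, hQ'g,
      fun x hx => hI.hrg x (hsub x hx), ?_⟩, by rw [hh0, abs_zero]; exact zpow_pos h2 g⟩
    · rw [IsExpansion, List.pairwise_append]
      exact ⟨hI.hexp, List.pairwise_singleton _ _, fun a _ b hb => by
        rw [List.mem_singleton.mp hb, hh0]; exact below_zero_right 1 a⟩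
    · intro x hx
      rcases List.mem_append.mp hx with hx | hx
      · exact hI.hhg x hx
      · rw [List.mem_singleton.mp hx, hh0, abs_zero]; exact zpow_pos h2 g
  · -- a nonzero output `h`, `2^T ≤ |h| < 2^(T+1)`: the new grid is `2^(T+1)`
    set T : ℤ := Int.log 2 |h| with hTdef
    have hTh : (2 : ℚ) ^ T ≤ |h| := zpow_log_le_abs hh0
    have hhT : |h| < (2 : ℚ) ^ (T + 1) := abs_lt_zpow_log_succ h
    have hgT : g ≤ T := by
      have : (2 : ℚ) ^ g < (2 : ℚ) ^ (T + 1) := lt_of_le_of_lt (hhg.two_zpow_le_abs hh0) hhT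
      have := (zpow_lt_zpow_iff_right₀ (by norm_num : (1:ℚ) < 2)).mp this; omega
    have hgT' : (2 : ℚ) ^ g ≤ (2 : ℚ) ^ T := zpow_le_zpow_right₀ (by norm_num) hgT
    -- `Q' = fl(Q + z)` is a multiple of `2·2^T` because its roundoff `h` is at least `2^T`
    have hQ'G : OnGrid (T + 1) Q' := by
      obtain ⟨s, hs, hlt⟩ := below_one_sub_fl hp1 hfl (Q + z)
      rw [one_mul, ← hh_eq] at hlt
      have hTs : T + 1 ≤ s := by
        have := (zpow_lt_zpow_iff_right₀ (by norm_num : (1:ℚ) < 2)).mp (lt_of_le_of_lt hTh hlt)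
        omega
      rw [hQ'eq]; exact hs.mono hTs
    -- every remaining input is a multiple of `2^(T+1)` (Lemma 15 + Corollary 8(a))
    have hrg' : ∀ x ∈ e₂' ++ f₂, OnGrid (T + 1) x := by
      intro x₀ hx₀
      by_contra hnot
      have hx₀0 : x₀ ≠ 0 := fun h0 => hnot (h0 ▸ OnGrid.zero _)
      -- Lemma 15 (second bound) for the processed parts, `x₀` being the largest summand
      have hL : |(e₁ ++ [z]).sum + f₁.sum| < (2 : ℚ) ^ (T + p) := by
        rcases List.mem_append.mp hx₀ with hx₀e | hx₀f
        · -- `x₀` is an unprocessed component of `e`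
          obtain ⟨A, B, hAB⟩ := List.append_of_mem hx₀e
          have hsubl : ((e₁ ++ [z]) ++ [x₀]).Sublist e := by
            rw [he', hAB]
            exact (List.Sublist.refl _).append
              (List.singleton_sublist.mpr (List.mem_append_right _ List.mem_cons_self))
          exact (lemma15 hp (fun y hy => heF y (hsubl.subset hy)) (hes.sublist hsubl)
            (fun y hy => hfF y (by rw [hI.hf]; exact List.mem_append_left _ hy))
            (hfs.sublist (by rw [hI.hf]; exact List.sublist_append_left f₁ f₂))
            (fun y hy => hI.hle y (List.mem_append_right _ hy) x₀ (hsub x₀ hx₀) hx₀0) hnot).2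
        · -- `x₀` is an unprocessed component of `f`
          obtain ⟨A, B, hAB⟩ := List.append_of_mem hx₀f
          have hsubl : (f₁ ++ [x₀]).Sublist f := by
            rw [hI.hf, hAB]
            exact (List.Sublist.refl _).append
              (List.singleton_sublist.mpr (List.mem_append_right _ List.mem_cons_self))
          have hsuble : (e₁ ++ [z]).Sublist e := by
            rw [he']; exact List.sublist_append_left _ _
          have := (lemma15 hp (fun y hy => hfF y (hsubl.subset hy)) (hfs.sublist hsubl)
            (fun y hy => heF y (hsuble.subset hy)) (hes.sublist hsuble)
            (fun y hy => hle' y (List.mem_append_left _ hy) x₀ hx₀ hx₀0) hnot).2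
          rwa [add_comm] at this
      -- the outputs so far sum to less than `2^g ≤ 2^T`
      have hS : |hs.sum| < (2 : ℚ) ^ g :=
        abs_sum_lt_two_zpow_of_isExpansion hI.hhs hI.hexp hI.hhg
      -- hence `|Q + z| < 2^T (2^p + 1)`, contradicting Corollary 8(a) (`|h| ≥ 2^T`)
      have hC := le_abs_add_of_two_zpow_le_abs_err hp1 hfl hI.hQ hzF (i := T) (by rwa [← hh_eq])
      have hQz : Q + z = ((e₁ ++ [z]).sum + f₁.sum) - hs.sum := by
        have := hI.hsum
        rw [List.sum_append, List.sum_singleton]; linear_combination this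
      have hTp : (2 : ℚ) ^ T * (2 ^ p + 1) = (2 : ℚ) ^ (T + p) + (2 : ℚ) ^ T := by
        rw [zpow_add₀ (by norm_num : (2:ℚ) ≠ 0), zpow_natCast]; ring
      rw [hQz, hTp] at hC
      have htri : |((e₁ ++ [z]).sum + f₁.sum) - hs.sum| ≤ |(e₁ ++ [z]).sum + f₁.sum| + |hs.sum| :=
        abs_sub _ _
      linarith
    refine ⟨T + 1, ⟨he', hI.hf, hQ'F, hsum', hle', hhs', ?_, by have := hI.hg; omega, hQ'G, hrg',
      ?_⟩, hhT⟩
    · -- the EARLIER outputs lie 1-below `h` via the grid `2^g ∋ h`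
      rw [IsExpansion, List.pairwise_append]
      exact ⟨hI.hexp, List.pairwise_singleton _ _, fun a ha b hb => by
        rw [List.mem_singleton.mp hb]; exact ⟨g, hhg, by rw [one_mul]; exact hI.hhg a ha⟩⟩
    · intro x hx
      rcases List.mem_append.mp hx with hx | hx
      · exact lt_of_lt_of_le (hI.hhg x hx)
          (le_trans hgT' (zpow_le_zpow_right₀ (by norm_num) (by omega)))
      · rw [List.mem_singleton.mp hx]; exact hhT

/-- **LEMMA 16 by induction over the loop**: from any state satisfying the invariant, growing the
remaining merged components by the accumulator yields a nonoverlapping increasing expansion; each new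
output `h` lies on the current grid below every later output ("it follows that `h` is a
nonoverlapping expansion of increasing (except for zeros) components").
[cite: Shewchuk1997, Lemma 16 p. 321; Thm 13 p. 322–323 (proof)] -/
theorem FesInv.isExpansion_growExpansion (hp : 2 ≤ p) (hfl : IsRoundNearest p emin fl)
    {e f : List ℚ} (heF : ∀ x ∈ e, IsFloat p emin x) (hes : IsStrongExpansion e)
    (hfF : ∀ x ∈ f, IsFloat p emin x) (hfs : IsStrongExpansion f) :
    ∀ (rs e₁ f₁ e₂ f₂ : List ℚ) (Q : ℚ) (hs : List ℚ) (g : ℤ), mergeExpansions e₂ f₂ = rs →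
      FesInv p emin e f e₁ f₁ e₂ f₂ Q hs g → IsExpansion 1 (growExpansion fl rs Q) := by
  have hp1 : 1 ≤ p := le_trans (by norm_num) hp
  intro rs
  induction rs with
  | nil => intro e₁ f₁ e₂ f₂ Q hs g _ _; exact isExpansion_singleton 1 Q
  | cons z rs ih =>
    intro e₁ f₁ e₂ f₂ Q hs g hm hI
    rw [growExpansion_cons, isExpansion_cons]
    -- after the step, in either case, we are in a state `hI'` on a grid `2^g'` above `|h|`
    have key : ∃ (e₁' f₁' e₂' f₂' : List ℚ) (g' : ℤ), mergeExpansions e₂' f₂' = rs ∧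
        FesInv p emin e f e₁' f₁' e₂' f₂' (twoSum fl Q z).1 (hs ++ [(twoSum fl Q z).2]) g' ∧
        |(twoSum fl Q z).2| < (2 : ℚ) ^ g' := by
      rcases mergeExpansions_eq_cons hm with ⟨e₂', rfl, hrs, hhead⟩ | ⟨f₂', rfl, hrs, hhead⟩
      · -- `z` is the next component of `e`
        have hzle : ∀ x ∈ f₂, x ≠ 0 → |z| ≤ |x| := by
          intro x hx hx0
          cases f₂ with
          | nil => simp at hx
          | cons y ys =>
            have hzy := hhead y ys rfl
            rcases List.mem_cons.mp hx with rfl | hx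
            · exact hzy
            · have hpw := hfs.1
              rw [hI.hf, List.pairwise_append, List.pairwise_cons] at hpw
              exact le_trans hzy ((hpw.2.1.1 x hx).abs_lt hx0).le
        obtain ⟨g', hI', hlt⟩ := hI.step hp hfl heF hes hfF hfs hzle
        exact ⟨_, _, _, _, g', hrs.symm, hI', hlt⟩
      · -- `z` is the next component of `f`: the same step with the roles of `e` and `f` exchanged
        have hzle : ∀ x ∈ e₂, x ≠ 0 → |z| ≤ |x| := by
          intro x hx hx0
          cases e₂ with
          | nil => simp at hx
          | cons y ys =>
            have hzy := hhead y ys rfl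
            rcases List.mem_cons.mp hx with rfl | hx
            · exact hzy.le
            · have hpw := hes.1
              rw [hI.he, List.pairwise_append, List.pairwise_cons] at hpw
              exact le_trans hzy.le ((hpw.2.1.1 x hx).abs_lt hx0).le
        obtain ⟨g', hI', hlt⟩ := hI.swap.step hp hfl hfF hfs heF hes hzle
        exact ⟨_, _, _, _, g', hrs.symm, hI'.swap, hlt⟩
    obtain ⟨e₁', f₁', e₂', f₂', g', hrs, hI', hlt⟩ := key
    refine ⟨fun w hw => ?_, ih e₁' f₁' e₂' f₂' _ _ g' hrs hI'⟩
    -- every later output lies on the grid `2^g'` (grid invariant of GROW-EXPANSION), above `|h|`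
    have hrsF : ∀ x ∈ rs, IsFloat p emin x := fun x hx => by
      rw [← hrs, mem_mergeExpansions] at hx
      exact hx.elim (fun hx => heF x (by rw [hI'.he]; exact List.mem_append_right _ hx))
        fun hx => hfF x (by rw [hI'.hf]; exact List.mem_append_right _ hx)
    have hrsG : ∀ x ∈ rs, OnGrid g' x := fun x hx => by
      rw [← hrs, mem_mergeExpansions] at hx
      exact hI'.hrg x (List.mem_append.mpr hx)
    exact ⟨g', onGrid_of_mem_growExpansion hp1 hfl hI'.hg hI'.hQ hrsF hI'.hQg hrsG w hw,
      by rw [one_mul]; exact hlt⟩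

/-- **THEOREM 13 — the part that holds (Lemma 16 with Lemma 14), for ANY round-to-nearest and any
`p ≥ 2`.** "Let `e = Σᵢ₌₁^m eᵢ` and `f = Σᵢ₌₁ⁿ fᵢ` be strongly nonoverlapping expansions of `m` and
`n` `p`-bit components, respectively ... sorted in order of increasing magnitude, except that any of
the `eᵢ` or `fᵢ` may be zero. ... FAST-EXPANSION-SUM will produce a [nonoverlapping] expansion `h`
such that `h = Σᵢ₌₁^{m+n} hᵢ = e + f`, where the components of `h` are in order of increasing
magnitude, except that any of the `hᵢ` may be zero."  The printed conclusion "STRONGLY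
nonoverlapping" is false — see the module docstring (ERRATUM).
[cite: Shewchuk1997, Thm 13 p. 319–320; Lemma 16 p. 321] -/
theorem fastExpansionSum_nonoverlapping (hp : 2 ≤ p) (hfl : IsRoundNearest p emin fl)
    {e f : List ℚ} (heF : ∀ x ∈ e, IsFloat p emin x) (hes : IsStrongExpansion e)
    (hfF : ∀ x ∈ f, IsFloat p emin x) (hfs : IsStrongExpansion f) :
    IsExpansion 1 (fastExpansionSum fl e f) ∧ (fastExpansionSum fl e f).sum = e.sum + f.sum ∧
      (fastExpansionSum fl e f).length = e.length + f.length ∧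
      ∀ x ∈ fastExpansionSum fl e f, IsFloat p emin x := by
  have hp1 : 1 ≤ p := le_trans (by norm_num) hp
  have hgF : ∀ x ∈ mergeExpansions e f, IsFloat p emin x := fun x hx =>
    (mem_mergeExpansions.mp hx).elim (heF x) (hfF x)
  have hlen := length_mergeExpansions e f
  refine ⟨?_, sum_fastExpansionSum hp1 hfl heF hfF hes.pairwise_abs_le hfs.pairwise_abs_le, ?_, ?_⟩
  · have hmain := FesInv.isExpansion_growExpansion hp hfl heF hes hfF hfs (mergeExpansions e f)
      [] [] e f 0 [] emin rfl (FesInv.init heF hfF)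
    rcases hm : mergeExpansions e f with _ | ⟨g₁, gs⟩
    · simp only [fastExpansionSum, hm]; exact isExpansion_nil 1
    · rw [fastExpansionSum_eq_growExpansion hp1 hfl heF hfF hes.pairwise_abs_le
        hfs.pairwise_abs_le hm]
      rw [hm, growExpansion_cons, twoSum_zero_left hfl (hgF g₁ (hm ▸ List.mem_cons_self)),
        isExpansion_cons] at hmain
      exact hmain.2
  · rcases hm : mergeExpansions e f with _ | ⟨g₁, gs⟩
    · rw [hm] at hlen; simp only [fastExpansionSum, hm]; simpa using hlen
    · rw [fastExpansionSum_eq_growExpansion hp1 hfl heF hfF hes.pairwise_abs_le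
        hfs.pairwise_abs_le hm, length_growExpansion, ← hlen, hm, List.length_cons]
  · rcases hm : mergeExpansions e f with _ | ⟨g₁, gs⟩
    · simp [fastExpansionSum, hm]
    · rw [fastExpansionSum_eq_growExpansion hp1 hfl heF hfF hes.pairwise_abs_le
        hfs.pairwise_abs_le hm]
      exact isFloat_of_mem_growExpansion hfl (hgF g₁ (hm ▸ List.mem_cons_self))

/-- **THEOREM 13 in the paper's setting** ("assuming p ≥ 4 [and round-to-even tiebreaking, footnote
4]"): FAST-EXPANSION-SUM of two strongly nonoverlapping expansions under round-to-even is a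
nonoverlapping expansion with the correct sum, increasing except for zeros.
[cite: Shewchuk1997, Thm 13 p. 319–320] -/
theorem fastExpansionSum_nonoverlapping_roundTiesEven (hp : 4 ≤ p) {e f : List ℚ}
    (heF : ∀ x ∈ e, IsFloat p emin x) (hes : IsStrongExpansion e)
    (hfF : ∀ x ∈ f, IsFloat p emin x) (hfs : IsStrongExpansion f) :
    IsExpansion 1 (fastExpansionSum (roundTiesEven p emin) e f) ∧
      (fastExpansionSum (roundTiesEven p emin) e f).sum = e.sum + f.sum ∧
      (fastExpansionSum (roundTiesEven p emin) e f).length = e.length + f.length ∧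
      ∀ x ∈ fastExpansionSum (roundTiesEven p emin) e f, IsFloat p emin x :=
  fastExpansionSum_nonoverlapping (le_trans (by norm_num) hp)
    (isRoundNearest_roundTiesEven (le_trans (by norm_num) hp)) heF hes hfF hfs

/-- THEOREM 13, the nonoverlapping property in the paper's own words (Nonoverlapping in the sense of
§2.1 between any two output components). [cite: Shewchuk1997, Thm 13 p. 319; §2.1 p. 309] -/
theorem fastExpansionSum_pairwise_nonoverlapping (hp : 2 ≤ p) (hfl : IsRoundNearest p emin fl)
    {e f : List ℚ} (heF : ∀ x ∈ e, IsFloat p emin x) (hes : IsStrongExpansion e)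
    (hfF : ∀ x ∈ f, IsFloat p emin x) (hfs : IsStrongExpansion f) :
    (fastExpansionSum fl e f).Pairwise Nonoverlapping :=
  (fastExpansionSum_nonoverlapping hp hfl heF hes hfF hfs).1.imp fun hab => hab.nonoverlapping

end Literature.ComputerArithmetic.Shewchuk1997
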